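import Literature.NumberTheory.NumberFields.LeopoldtReflectionIsotypic
import Literature.NumberTheory.NumberFields.CMFieldRelativeClassNumberDivisibility
import Literature.NumberTheory.NumberFields.ClassGroupNormGalois
import Literature.NumberTheory.NumberFields.ClassGroupExtension
import HarnessLib

/-!
# Leopoldt's reflection theorem (isotypic form) — III: the vanishing form, pull-back and descent along a
# subfield, and the relative-class-number kill: «`p ∤ h⁻` of the ODD character field kills the EVEN eigenfunctionals»
# (Washington, *Cyclotomic Fields*, §10.2, Thm. 10.9; Lang, *Cyclotomic Fields I and II*, Ch. 13 §2, Thm. 2.1; Ch. 3 §4, Thm. 4.4)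

Topic `NumberTheory/NumberFields`; namespace `Literature.NumberTheory.NumberFields`.  Theorem-only file (no
definition, no named fact, no `sorry`), unconditional.  Written by the prover seat `bsd-potss-rkm` g41 (cell
`bsd-potss`, `--supports` stmt-BirchSwinnertonDyer-19196): the consumer-facing corollaries of
`LeopoldtReflectionIsotypic.lean` (`#{ψ-eigenfunctionals} ≤ #{ψ*-eigenclasses}` on the class group of a CM field
`L ∋ μ_p`, `ψ` even and non-trivial).

* §1 `IsCMField.eigenHom_classGroup_eq_zero_of_forall_eigenClass_eq_one` — VANISHING FORM: no non-trivial
  `ψ*`-eigenclass ⟹ every `ψ`-eigenfunctional on `Cl_L` vanishes ("`ε_j A = 0 ⟹ ε_i A = 0`").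
* §2 `classGroup_eq_one_of_smul_eq_pow_of_not_dvd_card_ker` — the RELATIVE-NORM KILL for eigenCLASSES (the
  tree's `addMonoidHom_classGroup_eq_zero_of_eigenvalue_ne_one_of_not_dvd_card_ker` is the eigenFUNCTIONAL
  form): `x ∈ Cl_K[p]`, `σ • x = x^a`, `a ≢ 1`, `p ∤ #ker N_{K/K^σ}` ⟹ `x = 1` (Lang's `x (σx)⁻¹ ∈ ker N`,
  Thm. 4.4; for a CM field and `σ` = complex conjugation, `#ker N = h⁻`).
* §3 `comp_classGroupNorm_smul`, `eq_zero_of_comp_classGroupNorm_eq_zero` — PULL-BACK: an eigenfunctional on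
  `Cl_K`, `K ⊆ L`, pulls back along `N_{L/K}` to an eigenfunctional on `Cl_L` (semilinear equivariance of the
  norm, tree `classGroupNorm_mulEquiv_intAut`), injectively when `p ∤ [L:K]` (`N ∘ i = [L:K]`).
* §4 `classGroupNorm_ne_one_of_eigenClass`, `smul_classGroupNorm_eq_pow_of_eigenClass` — DESCENT: a non-trivial
  eigenclass of `Cl_L[p]` fixed by `Gal(L/K)` has non-trivial norm in `Cl_K[p]` when `p ∤ [L:K]`
  (`i ∘ N = ∏_{Gal(L/K)}`), with the same eigen-relations under compatible automorphisms.
* §5 `IsCMField.eigenHom_eq_zero_of_reflection_of_eigenClass_test` / `…_of_not_dvd_card_ker` — THE HEADLINE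
  COROLLARIES: `L` CM ∋ `ζ_p`, Galois over `F`, `ψ` even non-trivial; `K_ev, K_od ⊆ L` of index prime to `p`,
  `K_od` fixed by the kernel of `ψ* = ωψ⁻¹`; EITHER an eigenclass test on `Cl(K_od)[p]`, OR `σ₁` an automorphism
  of `K_od` (over a subfield `K₀` with `K_od/K₀` Galois) under which `ψ*` is `≢ 1` and `p ∤ #ker N_{K_od/K₀}` (for
  `σ₁` = complex conjugation: `p ∤ h⁻(K_od)`).  Then EVERY additive `μ : Cl(K_ev) → ℤ/p` which is `ψ`-eigen
  under the restrictions of `Gal(L/F)` VANISHES — one datum of the odd field decides the even side (the cell's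
  use: both layer-zero eigen-tests of a reducible fine-Selmer row from `p ∤ h⁻(ℚ(χ_odd))`).

## References

* L. C. Washington, *Introduction to Cyclotomic Fields*, 2nd ed., GTM 83 (1997), §10.2, Thm. 10.9, Thm. 10.11;
  Thm. 10.1 / Thm. 4.10 (`h⁻`). [Washington1997]
* S. Lang, *Cyclotomic Fields I and II*, GTM 121 (1990), Ch. 13 §2, Thm. 2.1; Ch. 3 §4, Thm. 4.3, Thm. 4.4 and
  its proof. [Lang1990]
* J. Neukirch, *Algebraic Number Theory* (1999), Ch. III §1 Prop. (1.6) (ii), (iv). [NeukirchANT1999]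
* R. Okazaki, Acta Arith. 92 (2000), §5, proof of Prop. 27 (equivariance of the norm on class groups). [Okazaki2000]
-/

noncomputable section

open NumberField NumberField.IsCMField IsDedekindDomain Module IntermediateField
open scoped nonZeroDivisors

namespace Literature.NumberTheory.NumberFields

/-! ### §1. The vanishing form -/

section Vanishing

variable (F K : Type) [Field F] [NumberField F] [Field K] [NumberField K] [Algebra F K] [IsGalois F K]
  [IsCMField K]

/-- **Vanishing form**: under the hypotheses of the non-trivial even case, if `Cl_K` has NO non-trivial
`ψ*`-eigenclass (`x^p = 1`, `N_{K/K⁺} x = 1`, `σ • x = x^{ω(σ)ψ(σ⁻¹)}` force `x = 1`), then every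
`ψ`-eigenfunctional `μ : Cl_K → ℤ/p` vanishes ("`ε_j A = 0 ⟹ ε_i A = 0`").
[cite: Washington1997, §10.2, Thm. 10.9] -/
theorem IsCMField.eigenHom_classGroup_eq_zero_of_forall_eigenClass_eq_one {p : ℕ} (hp : p.Prime)
    (hp2 : p ≠ 2) {ζ : K} (hζ : IsPrimitiveRoot ζ p) (ψ ω : (K ≃ₐ[F] K) → ℕ)
    (hω : ∀ σ : K ≃ₐ[F] K, σ ζ = ζ ^ ω σ)
    (c₀ : K ≃ₐ[F] K) (hc₀ : ∀ x : K, c₀ x = complexConj K x) (hψc₀ : ψ c₀ ≡ 1 [MOD p])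
    (hψ : ∃ σ : K ≃ₐ[F] K, ¬ ψ σ ≡ 1 [MOD p])
    (hT : ∀ c : ClassGroup (𝓞 K), c ^ p = 1 → classGroupNorm (maximalRealSubfield K) K c = 1 →
      (∀ σ : K ≃ₐ[F] K, ClassGroup.mulEquiv (AmbiguousClass.intAut σ) c = c ^ (ω σ * ψ σ⁻¹)) → c = 1)
    (μ : Additive (ClassGroup (𝓞 K)) →+ ZMod p)
    (hμ : ∀ (σ : K ≃ₐ[F] K) (c : ClassGroup (𝓞 K)),
      μ (Additive.ofMul (ClassGroup.mulEquiv (AmbiguousClass.intAut σ) c)) = (ψ σ : ZMod p) * μ (Additive.ofMul c)) :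
    μ = 0 := by
  haveI : NeZero p := ⟨hp.ne_zero⟩
  have hle := IsCMField.natCard_eigenHom_classGroup_le_natCard_eigenClass_of_even F K hp hp2 hζ ψ ω hω c₀
    hc₀ hψc₀ hψ
  -- the target is a singleton
  haveI : Subsingleton {c : ClassGroup (𝓞 K) // c ^ p = 1 ∧
      classGroupNorm (maximalRealSubfield K) K c = 1 ∧
        ∀ σ : K ≃ₐ[F] K, ClassGroup.mulEquiv (AmbiguousClass.intAut σ) c = c ^ (ω σ * ψ σ⁻¹)} :=
    ⟨fun a b => Subtype.ext ((hT a.1 a.2.1 a.2.2.1 a.2.2.2).trans (hT b.1 b.2.1 b.2.2.1 b.2.2.2).symm)⟩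
  have h1 : Nat.card {c : ClassGroup (𝓞 K) // c ^ p = 1 ∧
      classGroupNorm (maximalRealSubfield K) K c = 1 ∧
        ∀ σ : K ≃ₐ[F] K, ClassGroup.mulEquiv (AmbiguousClass.intAut σ) c = c ^ (ω σ * ψ σ⁻¹)} ≤ 1 :=
    Finite.card_le_one_iff_subsingleton.mpr inferInstance
  -- so the source has at most one element, and `0` is one of them
  have h0 : (0 : Additive (ClassGroup (𝓞 K)) →+ ZMod p) ∈ {ν : Additive (ClassGroup (𝓞 K)) →+ ZMod p |
      ∀ (σ : K ≃ₐ[F] K) (c : ClassGroup (𝓞 K)),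
        ν (Additive.ofMul (ClassGroup.mulEquiv (AmbiguousClass.intAut σ) c)) =
          (ψ σ : ZMod p) * ν (Additive.ofMul c)} := fun σ c => by simp
  haveI : Finite {ν : Additive (ClassGroup (𝓞 K)) →+ ZMod p //
      ∀ (σ : K ≃ₐ[F] K) (c : ClassGroup (𝓞 K)),
        ν (Additive.ofMul (ClassGroup.mulEquiv (AmbiguousClass.intAut σ) c)) =
          (ψ σ : ZMod p) * ν (Additive.ofMul c)} := by
    classical
    haveI : Finite (Additive (ClassGroup (𝓞 K)) →+ ZMod p) :=
      Finite.of_injective (fun f : Additive (ClassGroup (𝓞 K)) →+ ZMod p => (f : Additive (ClassGroup (𝓞 K)) → ZMod p))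
        DFunLike.coe_injective
    exact Subtype.finite
  have hsub : Subsingleton {ν : Additive (ClassGroup (𝓞 K)) →+ ZMod p //
      ∀ (σ : K ≃ₐ[F] K) (c : ClassGroup (𝓞 K)),
        ν (Additive.ofMul (ClassGroup.mulEquiv (AmbiguousClass.intAut σ) c)) =
          (ψ σ : ZMod p) * ν (Additive.ofMul c)} :=
    Finite.card_le_one_iff_subsingleton.mp (hle.trans h1)
  have := hsub.elim ⟨μ, hμ⟩ ⟨0, h0⟩
  exact congrArg Subtype.val this

end Vanishing

/-! ### §2. The relative-norm kill for eigenclasses -/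

section Kill

variable (K L : Type) [Field K] [NumberField K] [Field L] [NumberField L] [Algebra K L] [IsGalois K L]

/-- **Eigenclasses for a non-trivial eigenvalue are killed by the relative class number.**  `L/K` Galois,
`σ ∈ Gal(L/K)`, `p` prime with `p ∤ #ker (N_{L/K} : Cl_L → Cl_K)`, `x ∈ Cl_L` with `x^p = 1` and `σ • x = x^a`,
`a ≢ 1 (mod p)`.  Then `x = 1`: `x · (σ•x)⁻¹ ∈ ker N` (`N(σ•x) = N x`) is killed by `#ker N` and by `p`, so
`x = x^a`, and a non-trivial `x` would have order `p`.  (For a CM field `L`, `K = L⁺`, `σ` = complex conjugation: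
`#ker N = h⁻_L`, `a = −1`: «`p ∤ h⁻ ⟹ (Cl_L[p])⁻ = 1`».) [cite: Lang1990, Ch. 3 §4, Thm. 4.4 (proof)]
[cite: Washington1997, Thm. 10.1] -/
theorem classGroup_eq_one_of_smul_eq_pow_of_not_dvd_card_ker {p : ℕ} (hp : p.Prime) (σ : L ≃ₐ[K] L)
    (hker : ¬ p ∣ Nat.card (classGroupNorm K L).ker) {x : ClassGroup (𝓞 L)} (hx : x ^ p = 1) {a : ℕ}
    (ha : ¬ a ≡ 1 [MOD p]) (hσ : ClassGroup.mulEquiv (AmbiguousClass.intAut σ) x = x ^ a) : x = 1 := by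
  haveI : Fact p.Prime := ⟨hp⟩
  -- `d = x (σ x)⁻¹ ∈ ker N`, killed by `#ker N` and by `p`
  have hmem : x * (ClassGroup.mulEquiv (AmbiguousClass.intAut σ) x)⁻¹ ∈ (classGroupNorm K L).ker := by
    rw [MonoidHom.mem_ker, map_mul, map_inv, classGroupNorm_galois_smul, mul_inv_cancel]
  have h1 : (x * (ClassGroup.mulEquiv (AmbiguousClass.intAut σ) x)⁻¹) ^ Nat.card (classGroupNorm K L).ker = 1 := by
    have h := (pow_card_eq_one' : (⟨_, hmem⟩ : (classGroupNorm K L).ker) ^ Nat.card (classGroupNorm K L).ker = 1)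
    exact congrArg Subtype.val h
  have h2 : (x * (ClassGroup.mulEquiv (AmbiguousClass.intAut σ) x)⁻¹) ^ p = 1 := by
    rw [hσ, mul_pow, inv_pow, ← pow_mul, mul_comm a p, pow_mul, hx, one_pow, inv_one, mul_one]
  have hg : Nat.gcd (Nat.card (classGroupNorm K L).ker) p = 1 :=
    Nat.Coprime.gcd_eq_one (Nat.coprime_comm.mp ((Nat.Prime.coprime_iff_not_dvd hp).mpr hker))
  have h3 : x * (ClassGroup.mulEquiv (AmbiguousClass.intAut σ) x)⁻¹ = 1 := by
    have h4 : (x * (ClassGroup.mulEquiv (AmbiguousClass.intAut σ) x)⁻¹) ^ 1 = 1 := by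
      rw [← hg]
      exact pow_gcd_eq_one.mpr ⟨h1, h2⟩
    rwa [pow_one] at h4
  rw [hσ, mul_inv_eq_one] at h3
  -- `x = x^a` with `a ≢ 1`: a non-trivial `x` would have order `p`
  by_contra hne
  have hord : orderOf x = p := orderOf_eq_prime hx hne
  have h5 : x ^ 1 = x ^ a := by rw [pow_one]; exact h3
  rw [pow_eq_pow_iff_modEq, hord] at h5
  exact ha h5.symm

end Kill

/-! ### §3. Pull-back of eigenfunctionals along the norm -/

section Pullback

variable {F : Type*} [Field F] (K L : Type) [Field K] [NumberField K] [Field L] [NumberField L]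
  [Algebra F K] [Algebra F L] [Algebra K L]

/-- **`μ ∘ N_{L/K}` is an eigenfunctional on `Cl_L`** when `μ` is an eigenfunctional on `Cl_K` for the
restrictions: if `σ ∈ Aut(L/F)` restricts to `σ_K` on `K` and `μ(σ_K • d) = n μ(d)` for all `d`, then
`(μ ∘ N)(σ • c) = n (μ ∘ N)(c)` (`N(σ • c) = σ_K • N c`, tree `classGroupNorm_mulEquiv_intAut`).
[cite: Okazaki2000, §5, proof of Prop. 27] [cite: NeukirchANT1999, Ch. III §1 Prop. (1.6)] -/
theorem comp_classGroupNorm_smul {p : ℕ} (μ : Additive (ClassGroup (𝓞 K)) →+ ZMod p) (σ : L ≃ₐ[F] L)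
    (σK : K ≃ₐ[F] K) (hσ : ∀ x : K, σ (algebraMap K L x) = algebraMap K L (σK x)) (n : ZMod p)
    (hμ : ∀ d : ClassGroup (𝓞 K),
      μ (Additive.ofMul (ClassGroup.mulEquiv (AmbiguousClass.intAut σK) d)) = n * μ (Additive.ofMul d))
    (c : ClassGroup (𝓞 L)) :
    (μ.comp (classGroupNorm K L).toAdditive)
        (Additive.ofMul (ClassGroup.mulEquiv (AmbiguousClass.intAut σ) c)) =
      n * (μ.comp (classGroupNorm K L).toAdditive) (Additive.ofMul c) := by
  change μ (Additive.ofMul (classGroupNorm K L (ClassGroup.mulEquiv (AmbiguousClass.intAut σ) c))) =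
    n * μ (Additive.ofMul (classGroupNorm K L c))
  rw [classGroupNorm_mulEquiv_intAut K L σ σK hσ c, hμ]

/-- **`μ ∘ N_{L/K} = 0 ⟹ μ = 0` when `p ∤ [L : K]`**: `μ(d)^{[L:K]} = μ(N(i d)) = 0` and `[L:K]` is a unit
mod `p` (`N_{L/K} ∘ i_{L/K} = [L:K]`, tree `classGroupNorm_classGroupExtend`).
[cite: NeukirchANT1999, Ch. III §1 Prop. (1.6) (ii)] -/
theorem eq_zero_of_comp_classGroupNorm_eq_zero {p : ℕ} [Fact p.Prime] (hpd : ¬ p ∣ Module.finrank K L)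
    (μ : Additive (ClassGroup (𝓞 K)) →+ ZMod p) (h0 : μ.comp (classGroupNorm K L).toAdditive = 0) :
    μ = 0 := by
  refine AddMonoidHom.ext fun x => ?_
  obtain ⟨d, rfl⟩ : ∃ d : ClassGroup (𝓞 K), Additive.ofMul d = x := ⟨Additive.toMul x, rfl⟩
  have h1 : μ (Additive.ofMul (classGroupNorm K L (classGroupExtend K L d))) = 0 := by
    have := congrArg (fun f : Additive (ClassGroup (𝓞 L)) →+ ZMod p => f (Additive.ofMul (classGroupExtend K L d))) h0
    simpa using this
  rw [classGroupNorm_classGroupExtend, ofMul_pow, map_nsmul, nsmul_eq_mul] at h1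
  have hu : ((Module.finrank K L : ℕ) : ZMod p) ≠ 0 := by
    rw [Ne, ZMod.natCast_eq_zero_iff]
    exact hpd
  rw [AddMonoidHom.zero_apply]
  exact (mul_eq_zero.mp h1).resolve_left hu

end Pullback

/-! ### §4. Descent of eigenclasses along the norm -/

section Descent

variable {F : Type*} [Field F] (K L : Type) [Field K] [NumberField K] [Field L] [NumberField L]
  [Algebra F K] [Algebra F L] [Algebra K L] [IsScalarTower F K L] [IsGalois K L]

omit [NumberField K] [NumberField L] [IsGalois K L] in
/-- `intAut` of a `K`-automorphism of `L` is `intAut` of the same automorphism viewed over `F`. [folklore] -/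
private theorem intAut_restrictScalars (h : L ≃ₐ[K] L) :
    AmbiguousClass.intAut (h.restrictScalars F) = AmbiguousClass.intAut h :=
  RingEquiv.ext fun _ => Subtype.ext rfl

/-- **The norm of a `Gal(L/K)`-fixed class: `i(N x) = x^{[L:K]}`**, so for `x ∈ Cl_L[p]`, `x ≠ 1`, `p ∤ [L:K]`:
`N_{L/K} x ≠ 1` (and `(N x)^p = 1`).  Here «fixed» is supplied by eigen-relations `σ • x = x^{m σ}` over `F` with
`m ≡ 1 (mod p)` on `Gal(L/K)`. [cite: NeukirchANT1999, Ch. III §1 Prop. (1.6) (iv)] [cite: Washington1997, §10.2, Thm. 10.9 (proof)] -/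
theorem classGroupNorm_ne_one_of_eigenClass {p : ℕ} (hp : p.Prime) (hpd : ¬ p ∣ Module.finrank K L)
    (m : (L ≃ₐ[F] L) → ℕ) (hfix : ∀ h : L ≃ₐ[K] L, m (h.restrictScalars F) ≡ 1 [MOD p])
    {x : ClassGroup (𝓞 L)} (hx1 : x ≠ 1) (hxp : x ^ p = 1)
    (heig : ∀ σ : L ≃ₐ[F] L, ClassGroup.mulEquiv (AmbiguousClass.intAut σ) x = x ^ m σ) :
    classGroupNorm K L x ≠ 1 ∧ classGroupNorm K L x ^ p = 1 := by
  classical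
  haveI : Fact p.Prime := ⟨hp⟩
  refine ⟨fun hN => hx1 ?_, by rw [← map_pow, hxp, map_one]⟩
  -- `i(N x) = ∏_h h • x = x ^ #Gal(L/K) = x ^ [L:K]`
  have hfixed : ∀ h : L ≃ₐ[K] L, ClassGroup.mulEquiv (AmbiguousClass.intAut h) x = x := by
    intro h
    rw [← intAut_restrictScalars (F := F) K L h, heig]
    have h1 : x ^ m (h.restrictScalars F) = x ^ 1 := by
      obtain hx | hx := eq_or_ne x 1
      · rw [hx, one_pow, one_pow]
      · rw [pow_eq_pow_iff_modEq, orderOf_eq_prime hxp hx]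
        exact hfix h
    rw [h1, pow_one]
  have hprod := classGroupExtend_classGroupNorm_eq_prod K L x
  rw [hN, map_one, Finset.prod_congr rfl fun h _ => hfixed h, Finset.prod_const, Finset.card_univ,
    ← Nat.card_eq_fintype_card, IsGalois.card_aut_eq_finrank] at hprod
  -- `x ^ [L:K] = 1` and `x ^ p = 1` with `gcd = 1`
  have hg : Nat.gcd (Module.finrank K L) p = 1 :=
    Nat.Coprime.gcd_eq_one (Nat.coprime_comm.mp ((Nat.Prime.coprime_iff_not_dvd hp).mpr hpd))
  have h4 : x ^ 1 = 1 := by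
    rw [← hg]
    exact pow_gcd_eq_one.mpr ⟨hprod.symm, hxp⟩
  rwa [pow_one] at h4

omit [Algebra F K] [IsScalarTower F K L] [IsGalois K L] in
/-- **The norm of an eigenclass is an eigenclass**: if `σ ∈ Aut(L/F)` restricts to an automorphism `σ_K` of `K`
(linear over any subfield) and `σ • x = x^m`, then `σ_K • N_{L/K} x = (N_{L/K} x)^m`.
[cite: Okazaki2000, §5, proof of Prop. 27] [cite: NeukirchANT1999, Ch. III §1 Prop. (1.6)] -/
theorem smul_classGroupNorm_eq_pow_of_eigenClass {E' : Type*} [Field E'] [Algebra E' K] (σ : L ≃ₐ[F] L)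
    (σK : K ≃ₐ[E'] K) (hσ : ∀ y : K, σ (algebraMap K L y) = algebraMap K L (σK y))
    {x : ClassGroup (𝓞 L)} {m : ℕ} (heig : ClassGroup.mulEquiv (AmbiguousClass.intAut σ) x = x ^ m) :
    ClassGroup.mulEquiv (AmbiguousClass.intAut σK) (classGroupNorm K L x) = classGroupNorm K L x ^ m := by
  rw [← classGroupNorm_mulEquiv_intAut K L σ σK hσ x, heig, map_pow]

end Descent

/-! ### §5. The headline corollaries: the odd field decides the even eigenfunctionals -/

section Headline

variable (F L : Type) [Field F] [NumberField F] [Field L] [NumberField L] [Algebra F L] [IsGalois F L]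
  [IsCMField L]

omit [NumberField F] [IsGalois F L] in
/-- **Complex conjugation acts on `μ_p` by `−1`: `ω(c₀) ≡ p − 1 (mod p)`** for any exponent system `ω` with `σ ζ = ζ^{ω σ}`
on a CM field (`ζ̄ = ζ⁻¹`). [cite: Washington1997, §10.2, Thm. 10.9 (proof)] [cite: Lang1990, Ch. 13 §2, Thm. 2.1 (proof)] -/
theorem IsCMField.modEq_sub_one_of_complexConj {p : ℕ} (hp : p.Prime) {ζ : L} (hζ : IsPrimitiveRoot ζ p)
    (ω : (L ≃ₐ[F] L) → ℕ) (hω : ∀ σ : L ≃ₐ[F] L, σ ζ = ζ ^ ω σ)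
    (c₀ : L ≃ₐ[F] L) (hc₀ : ∀ x : L, c₀ x = complexConj L x) : ω c₀ ≡ p - 1 [MOD p] := by
  have h1 : ζ ^ (ω c₀ + 1) = 1 := by
    rw [pow_succ, ← hω, hc₀, IsCMField.complexConj_eq_inv_of_pow_eq_one _ hp.ne_zero hζ.pow_eq_one,
      inv_mul_cancel₀ (hζ.ne_zero hp.ne_zero)]
  have hdvd : p ∣ ω c₀ + 1 := (hζ.pow_eq_one_iff_dvd _).mp h1
  have h2 : ω c₀ + 1 ≡ (p - 1) + 1 [MOD p] := by
    rw [Nat.sub_add_cancel hp.one_le]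
    exact (Nat.modEq_zero_iff_dvd.mpr hdvd).trans (Nat.modEq_zero_iff_dvd.mpr (dvd_refl p)).symm
  exact Nat.ModEq.add_right_cancel' 1 h2

omit [NumberField F] [IsGalois F L] in
/-- **`ψ(σ⁻¹) ψ(σ) ≡ 1`-free bookkeeping: if `ω ≡ a·ψ` pointwise (`ω σ ≡ a σ * ψ σ`), `a(c₀) ≡ p − 1` and `ψ` is arbitrary, then
`ψ(c₀) ≡ 1 (mod p)`** — from `ω(c₀) ≡ p − 1` (previous lemma) by cancelling the unit `p − 1`.  (On a reducible row: `a = χ₁` odd forces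
`ψ = χ₂` even.) [cite: Washington1997, §10.2, Thm. 10.9 (proof)] -/
theorem IsCMField.modEq_one_of_mul_of_complexConj {p : ℕ} (hp : p.Prime) {ζ : L} (hζ : IsPrimitiveRoot ζ p)
    (a ψ ω : (L ≃ₐ[F] L) → ℕ) (hω : ∀ σ : L ≃ₐ[F] L, σ ζ = ζ ^ ω σ) (haψ : ∀ σ, ω σ = a σ * ψ σ)
    (c₀ : L ≃ₐ[F] L) (hc₀ : ∀ x : L, c₀ x = complexConj L x) (ha : a c₀ ≡ p - 1 [MOD p]) :
    ψ c₀ ≡ 1 [MOD p] := by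
  have h1 := IsCMField.modEq_sub_one_of_complexConj F L hp hζ ω hω c₀ hc₀
  rw [haψ] at h1
  have hp2 := hp.two_le
  have hcop : Nat.Coprime p (p - 1) :=
    (Nat.Prime.coprime_iff_not_dvd hp).mpr fun h => by have := Nat.le_of_dvd (by omega) h; omega
  have h3 : (p - 1) * ψ c₀ ≡ (p - 1) * 1 [MOD p] := by
    rw [mul_one]
    exact (ha.symm.mul_right _).trans h1
  exact Nat.ModEq.cancel_left_of_coprime hcop h3

/-- **An eigenclass test on the ODD character field kills the `ψ`-eigenfunctionals of the EVEN character field.**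
`L` a CM number field containing a primitive `p`-th root of unity `ζ` (`p` odd), Galois over `F` with complex
conjugation `c₀ ∈ Gal(L/F)`; `ψ ω : Gal(L/F) → ℕ` with `σ ζ = ζ^{ω σ}`, `ψ(c₀) ≡ 1`, `ψ ≢ 1` somewhere; subfields
`K_ev ⊆ L` and `K_od ⊆ L` of index prime to `p`, `L/K_od` Galois with `ω ψ⁻¹ ≡ 1` on `Gal(L/K_od)` (i.e. `K_od ⊇`
the field of `ψ* = ωψ⁻¹`), and the EIGENCLASS TEST on `K_od`: every `x ∈ Cl(K_od)[p]` with `σ_K • x = x^{ω(σ)ψ(σ⁻¹)}`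
for all `σ ∈ Gal(L/F)` restricting to `σ_K` on `K_od` is trivial (e.g. certified from the structure of `Cl(K_od)` as a
Galois module, or by `p ∤ h⁻`: next theorem).  Then every additive `μ : Cl(K_ev) → ℤ/p` which is `ψ`-eigen under
restrictions of `Gal(L/F)` is ZERO.  Proof: pull `μ` back to `Cl_L` along `N_{L/K_ev}` (§3), apply the reflection
theorem (§1), descend a putative `ψ*`-eigenclass to `Cl(K_od)` (§4). [cite: Washington1997, §10.2, Thm. 10.9]
[cite: Lang1990, Ch. 13 §2, Thm. 2.1] -/
theorem IsCMField.eigenHom_eq_zero_of_reflection_of_eigenClass_test {p : ℕ} (hp : p.Prime) (hp2 : p ≠ 2)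
    {ζ : L} (hζ : IsPrimitiveRoot ζ p) (ψ ω : (L ≃ₐ[F] L) → ℕ) (hω : ∀ σ : L ≃ₐ[F] L, σ ζ = ζ ^ ω σ)
    (c₀ : L ≃ₐ[F] L) (hc₀ : ∀ x : L, c₀ x = complexConj L x) (hψc₀ : ψ c₀ ≡ 1 [MOD p])
    (hψ : ∃ σ : L ≃ₐ[F] L, ¬ ψ σ ≡ 1 [MOD p])
    (Kev : Type) [Field Kev] [NumberField Kev] [Algebra F Kev] [Algebra Kev L] [IsScalarTower F Kev L]
    (hpev : ¬ p ∣ Module.finrank Kev L)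
    (Kod : Type) [Field Kod] [NumberField Kod] [Algebra F Kod] [Algebra Kod L] [IsScalarTower F Kod L]
    [IsGalois Kod L] (hpod : ¬ p ∣ Module.finrank Kod L)
    (hfix : ∀ h : L ≃ₐ[Kod] L, ω (h.restrictScalars F) * ψ (h.restrictScalars F)⁻¹ ≡ 1 [MOD p])
    (hkill : ∀ x : ClassGroup (𝓞 Kod), x ^ p = 1 →
      (∀ (σ : L ≃ₐ[F] L) (σK : Kod ≃ₐ[F] Kod), (∀ y : Kod, σ (algebraMap Kod L y) = algebraMap Kod L (σK y)) →
        ClassGroup.mulEquiv (AmbiguousClass.intAut σK) x = x ^ (ω σ * ψ σ⁻¹)) → x = 1)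
    (μ : Additive (ClassGroup (𝓞 Kev)) →+ ZMod p)
    (hμ : ∀ σ : L ≃ₐ[F] L, ∃ σK : Kev ≃ₐ[F] Kev, (∀ y : Kev, σ (algebraMap Kev L y) = algebraMap Kev L (σK y)) ∧
      ∀ d : ClassGroup (𝓞 Kev),
        μ (Additive.ofMul (ClassGroup.mulEquiv (AmbiguousClass.intAut σK) d)) = (ψ σ : ZMod p) * μ (Additive.ofMul d)) :
    μ = 0 := by
  haveI : Fact p.Prime := ⟨hp⟩
  -- pull back to `Cl_L`
  set ν : Additive (ClassGroup (𝓞 L)) →+ ZMod p := μ.comp (classGroupNorm Kev L).toAdditive with hν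
  have hν_eig : ∀ (σ : L ≃ₐ[F] L) (c : ClassGroup (𝓞 L)),
      ν (Additive.ofMul (ClassGroup.mulEquiv (AmbiguousClass.intAut σ) c)) = (ψ σ : ZMod p) * ν (Additive.ofMul c) := by
    intro σ c
    obtain ⟨σK, hσK, hμσ⟩ := hμ σ
    exact comp_classGroupNorm_smul Kev L μ σ σK hσK (ψ σ : ZMod p) hμσ c
  -- reflection: `ν = 0` once `L` has no non-trivial `ψ*`-eigenclass
  have hT : ∀ c : ClassGroup (𝓞 L), c ^ p = 1 → classGroupNorm (maximalRealSubfield L) L c = 1 →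
      (∀ σ : L ≃ₐ[F] L, ClassGroup.mulEquiv (AmbiguousClass.intAut σ) c = c ^ (ω σ * ψ σ⁻¹)) → c = 1 := by
    intro c hcp _ heig
    by_contra hc1
    -- descend to `K_od` and kill
    obtain ⟨hN1, hNp⟩ := classGroupNorm_ne_one_of_eigenClass (F := F) Kod L hp hpod
      (fun σ => ω σ * ψ σ⁻¹) hfix hc1 hcp heig
    exact hN1 (hkill _ hNp fun σ σK hσK =>
      smul_classGroupNorm_eq_pow_of_eigenClass (F := F) Kod L σ σK hσK (heig σ))
  have hν0 : ν = 0 :=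
    IsCMField.eigenHom_classGroup_eq_zero_of_forall_eigenClass_eq_one F L hp hp2 hζ ψ ω hω c₀ hc₀ hψc₀ hψ
      hT ν hν_eig
  exact eq_zero_of_comp_classGroupNorm_eq_zero Kev L hpev μ hν0

/-- **`p ∤ #ker N` on the ODD character field kills the `ψ`-eigenfunctionals of the EVEN character field** — the
eigenclass test of the previous theorem discharged by ONE integer: an automorphism `σ₁` of `K_od` over a subfield
`K₀` (`K_od/K₀` Galois; `F ⊆ K₀`), the restriction of some `τ₁ ∈ Gal(L/F)` with `ω(τ₁)ψ(τ₁⁻¹) ≢ 1 (mod p)`, and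
**`p ∤ #ker (N : Cl(K_od) → Cl(K₀))`** (§2).  For `σ₁` = complex conjugation of an (imaginary abelian) `K_od` this
integer is the relative class number `h⁻(K_od) = h(K_od)/h(K_od⁺)` — «one integer of the odd field decides the even
side». [cite: Washington1997, §10.2, Thm. 10.9; Thm. 10.1] [cite: Lang1990, Ch. 13 §2, Thm. 2.1; Ch. 3 §4, Thm. 4.4] -/
theorem IsCMField.eigenHom_eq_zero_of_reflection_of_not_dvd_card_ker {p : ℕ} (hp : p.Prime) (hp2 : p ≠ 2)
    {ζ : L} (hζ : IsPrimitiveRoot ζ p) (ψ ω : (L ≃ₐ[F] L) → ℕ) (hω : ∀ σ : L ≃ₐ[F] L, σ ζ = ζ ^ ω σ)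
    (c₀ : L ≃ₐ[F] L) (hc₀ : ∀ x : L, c₀ x = complexConj L x) (hψc₀ : ψ c₀ ≡ 1 [MOD p])
    (hψ : ∃ σ : L ≃ₐ[F] L, ¬ ψ σ ≡ 1 [MOD p])
    (Kev : Type) [Field Kev] [NumberField Kev] [Algebra F Kev] [Algebra Kev L] [IsScalarTower F Kev L]
    (hpev : ¬ p ∣ Module.finrank Kev L)
    (Kod : Type) [Field Kod] [NumberField Kod] [Algebra F Kod] [Algebra Kod L] [IsScalarTower F Kod L]
    [IsGalois Kod L] (hpod : ¬ p ∣ Module.finrank Kod L)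
    (hfix : ∀ h : L ≃ₐ[Kod] L, ω (h.restrictScalars F) * ψ (h.restrictScalars F)⁻¹ ≡ 1 [MOD p])
    {K₀ : Type} [Field K₀] [NumberField K₀] [Algebra F K₀] [Algebra K₀ Kod] [IsScalarTower F K₀ Kod]
    [IsGalois K₀ Kod] (σ₁ : Kod ≃ₐ[K₀] Kod)
    (τ₁ : L ≃ₐ[F] L) (hτ₁ : ∀ y : Kod, τ₁ (algebraMap Kod L y) = algebraMap Kod L (σ₁ y))
    (ha : ¬ ω τ₁ * ψ τ₁⁻¹ ≡ 1 [MOD p]) (hker : ¬ p ∣ Nat.card (classGroupNorm K₀ Kod).ker)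
    (μ : Additive (ClassGroup (𝓞 Kev)) →+ ZMod p)
    (hμ : ∀ σ : L ≃ₐ[F] L, ∃ σK : Kev ≃ₐ[F] Kev, (∀ y : Kev, σ (algebraMap Kev L y) = algebraMap Kev L (σK y)) ∧
      ∀ d : ClassGroup (𝓞 Kev),
        μ (Additive.ofMul (ClassGroup.mulEquiv (AmbiguousClass.intAut σK) d)) = (ψ σ : ZMod p) * μ (Additive.ofMul d)) :
    μ = 0 := by
  refine IsCMField.eigenHom_eq_zero_of_reflection_of_eigenClass_test F L hp hp2 hζ ψ ω hω c₀ hc₀ hψc₀ hψ Kev hpev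
    Kod hpod hfix (fun x hxp heig => ?_) μ hμ
  have h1 := heig τ₁ (σ₁.restrictScalars F) (fun y => hτ₁ y)
  have h2 : ClassGroup.mulEquiv (AmbiguousClass.intAut σ₁) x = x ^ (ω τ₁ * ψ τ₁⁻¹) := by
    have : AmbiguousClass.intAut (σ₁.restrictScalars F) = AmbiguousClass.intAut σ₁ :=
      RingEquiv.ext fun _ => Subtype.ext rfl
    rw [← this]; exact h1
  exact classGroup_eq_one_of_smul_eq_pow_of_not_dvd_card_ker K₀ Kod hp σ₁ hker hxp ha h2

end Headline

end Literature.NumberTheory.NumberFields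

end
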